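import Summits.BirchSwinnertonDyer.BirchSwinnertonDyer.Theorems.Rank2ObservatoryRank3TamCerts1
import Summits.BirchSwinnertonDyer.BirchSwinnertonDyer.Theorems.Rank2ObservatoryRank3TamCerts2
import Summits.BirchSwinnertonDyer.BirchSwinnertonDyer.Theorems.Rank2ObservatoryRank3TamCerts3
import Summits.BirchSwinnertonDyer.BirchSwinnertonDyer.Theorems.Rank2ObservatoryRank3TamCerts4
import Summits.BirchSwinnertonDyer.BirchSwinnertonDyer.Theorems.Rank2ObservatoryRank3TamCerts5
import Summits.BirchSwinnertonDyer.BirchSwinnertonDyer.Theorems.Rank2ObservatoryRank3TamCerts6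
import Summits.BirchSwinnertonDyer.BirchSwinnertonDyer.Theorems.Rank2ObservatoryRank3TamCerts7
import Summits.BirchSwinnertonDyer.BirchSwinnertonDyer.Theorems.Rank2ObservatoryRank3TamCerts8
import Summits.BirchSwinnertonDyer.BirchSwinnertonDyer.Theorems.Rank2ObservatoryRank3TamCerts9
import Summits.BirchSwinnertonDyer.BirchSwinnertonDyer.Theorems.Rank2ObservatoryRank3TamCerts10
import Summits.BirchSwinnertonDyer.BirchSwinnertonDyer.Theorems.Rank2ObservatoryRank3TamCerts11
import Summits.BirchSwinnertonDyer.BirchSwinnertonDyer.Theorems.Rank2ObservatoryRank3TamCerts12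
import Summits.BirchSwinnertonDyer.BirchSwinnertonDyer.Theorems.Rank2ObservatoryRank3TamCerts13
import Summits.BirchSwinnertonDyer.BirchSwinnertonDyer.Theorems.Rank2ObservatoryRank3TamCerts14
import Summits.BirchSwinnertonDyer.BirchSwinnertonDyer.Theorems.Rank2ObservatoryRank3TamCerts15
import Summits.BirchSwinnertonDyer.BirchSwinnertonDyer.Theorems.Rank2ObservatoryRank3TamCerts16
import Summits.BirchSwinnertonDyer.BirchSwinnertonDyer.Theorems.Rank2ObservatoryRank3TamCerts17
import Summits.BirchSwinnertonDyer.BirchSwinnertonDyer.Theorems.Rank2ObservatoryRank3TamCerts18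
import Summits.BirchSwinnertonDyer.BirchSwinnertonDyer.Theorems.Rank2ObservatoryRank3TamCerts19
import Summits.BirchSwinnertonDyer.BirchSwinnertonDyer.Theorems.Rank2ObservatoryRank3TamCerts20
import Summits.BirchSwinnertonDyer.BirchSwinnertonDyer.Theorems.Rank2ObservatoryRank3TamCerts21
import Summits.BirchSwinnertonDyer.BirchSwinnertonDyer.Theorems.Rank2ObservatoryRank3TamCerts22
import Summits.BirchSwinnertonDyer.BirchSwinnertonDyer.Theorems.Rank2ObservatoryRank3TamCerts23
import Summits.BirchSwinnertonDyer.BirchSwinnertonDyer.Theorems.Rank2ObservatoryRank3TamCerts24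
import Summits.BirchSwinnertonDyer.BirchSwinnertonDyer.Theorems.Rank2ObservatoryRank3TamCerts25
import Summits.BirchSwinnertonDyer.BirchSwinnertonDyer.Theorems.Rank2ObservatoryRank3TamCerts26
import Summits.BirchSwinnertonDyer.BirchSwinnertonDyer.Theorems.Rank2ObservatoryRank3TamCerts27
import Summits.BirchSwinnertonDyer.BirchSwinnertonDyer.Theorems.Rank2ObservatoryRank3TamCerts28
import Summits.BirchSwinnertonDyer.BirchSwinnertonDyer.Theorems.Rank2ObservatoryRank3TamCerts29
import HarnessLib

/-!
# BirchSwinnertonDyer — rank ≥ 2 observatory: the KERNEL TAMAGAWA CENSUS of the rank-3 table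

HONEST FRAMING: per-curve certified theorems and census instruments; no claim on BSD in rank ≥ 2.

Census instrument (unit `b2b-bsdr2-cert-2`, gen 10), NO named fact, NO hypothesis: for EVERY one of the
`9487` rows of `rank3Table` (the Cremona/LMFDB curves of analytic rank `3` and conductor `< 500 000`, audited
gen 5) the 29 data chunks `rank3TamCerts1 … 29` list a ROW CERTIFICATE of its local Tamagawa numbers —
31050 local certificates `TamC` in all, one per bad prime: 11410 split multiplicative (root witness,
`c_p = v_p(Δ)`), 2227 + 11564 non-split (exhaustion at `p = 2` / Euler witness, `c_p = 2 | 1`), 2166 Step-2 Tate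
certificates (types `II`, `III`, `IV`) and 3683 deep Tate certificates (`I₀*`, `Iₙ*`, `IV*`, `III*`, `II*`) — and the
kernel has evaluated every chunk's walk (`rank3Table_tamWalkK`).  This file concatenates the chunks and proves:

* `rank3TamCerts_indices`: the listed indices are exactly `0, …, 9486` in order (every row certified once);
* `tamagawa_census`: for every listed `(i, R)` — row `i`'s TAMAGAWA PRODUCT `∏_v c_v` (the tree's
  `WeierstrassCurve.tamagawaProduct`, the BSD-formula factor) lies in the certified finite set `rowVals`, EQUALS
  the engines' product `rowValue` on kernel-exact rows, `c_v ∈ vals` at each bad place and `c_v = 1` elsewhere;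
  `tamagawaProduct_certified`: the same for every `i < rank3Table.length`;
* kernel-counted statistics: 5442 rows are KERNEL-EXACT (every bad place multiplicative or of type `II`, `III`,
  `III*`, `II*`: `∏_v c_v` is a certified numeral), the other 4045 rows are KERNEL-BRACKETED (`∏_v c_v` in a
  certified set of at most 12 values: the tree proves only `c ∈ {1,3}` for `IV`, `IV*`, `{1,2,4}` for `I₀*`,
  `{2,4}` for `Iₙ*`; exactness there needs the residual quadratic/cubic of Tate's algorithm, not yet in the
  tree); `∏_v c_v = 1` is kernel-certified for exactly 458 rows.

Cross-checks outside the proofs (cell dir `kernel-tam3/`): engine 1 (`tam.py`: Tate's algorithm with Silverman's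
`c`-rules) and engine 2 (PARI/GP `elllocalred`) agree on the Kodaira type, `c_p` and `f_p` at all 31050 bad primes;
the products agree with Cremona's `allbsd` column `CP` on all 9487 rows; `gen_tam_chunks.py` re-evaluates every
Boolean of `TamLocal.check` / `rowCheck` in Python.  References: [SilvermanATAEC1994] IV.9.4; [CremonaAlgorithms1997]
§3.2, Table 1; [SilvermanAEC2009] VII.5, C.16.
-/

set_option linter.dupNamespace false
set_option autoImplicit false

namespace Summit.BirchSwinnertonDyer.BirchSwinnertonDyer.Rank2Observatory.Tam

/-- ALL row certificates of the Tamagawa census: the concatenation of the 29 chunks.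
[cite: SilvermanATAEC1994, IV.9.4] -/
def rank3TamCerts : List (ℕ × List TamC) :=
  rank3TamCerts1 ++ rank3TamCerts2 ++ rank3TamCerts3 ++ rank3TamCerts4 ++ rank3TamCerts5 ++
    rank3TamCerts6 ++ rank3TamCerts7 ++ rank3TamCerts8 ++ rank3TamCerts9 ++ rank3TamCerts10 ++
    rank3TamCerts11 ++ rank3TamCerts12 ++ rank3TamCerts13 ++ rank3TamCerts14 ++ rank3TamCerts15 ++
    rank3TamCerts16 ++ rank3TamCerts17 ++ rank3TamCerts18 ++ rank3TamCerts19 ++ rank3TamCerts20 ++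
    rank3TamCerts21 ++ rank3TamCerts22 ++ rank3TamCerts23 ++ rank3TamCerts24 ++ rank3TamCerts25 ++
    rank3TamCerts26 ++ rank3TamCerts27 ++ rank3TamCerts28 ++ rank3TamCerts29

/-- COVERAGE (kernel): the listed row indices are exactly `0, …, 9486`, increasing — every census row has
exactly one row certificate. [cite: CremonaAlgorithms1997, Table 1] -/
theorem rank3TamCerts_indices : rank3TamCerts.map (·.1) = List.range 9487 := by
  decide +kernel

/-- Every index `i < 9487` is listed. [folklore] -/
theorem exists_listed {i : ℕ} (hi : i < 9487) : ∃ R, (i, R) ∈ rank3TamCerts := by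
  have hi' : i ∈ rank3TamCerts.map (·.1) := by
    rw [rank3TamCerts_indices]; exact List.mem_range.mpr hi
  obtain ⟨⟨j, R⟩, hm, hj⟩ := List.mem_map.mp hi'
  dsimp only at hj
  subst hj
  exact ⟨R, hm⟩

/-- **THE TAMAGAWA CENSUS** (NO named fact, NO hypothesis): for every listed `(i, R)`, row `i` of `rank3Table`
exists, its row certificate checks, its Tamagawa product `∏_v c_v` lies in `rowVals R` and equals `rowValue R`
when `R` is exact, `c_v ∈ E.vals` at the place over each listed prime and `c_v = 1` at every other finite
place. [cite: SilvermanATAEC1994, IV.9.4] [cite: CremonaAlgorithms1997, Table 1] -/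
theorem tamagawa_census {i : ℕ} {R : List TamC} (hm : (i, R) ∈ rank3TamCerts) :
    ∃ hi : i < rank3Table.length,
      TamLocal.rowCheck (R.map TamC.toLocal) (rank3Table[i]'hi).intModel = true ∧
      (rank3Table[i]'hi).curve.tamagawaProduct ∈ TamLocal.rowVals (R.map TamC.toLocal) ∧
      (TamLocal.rowExact (R.map TamC.toLocal) = true →
        (rank3Table[i]'hi).curve.tamagawaProduct = TamLocal.rowValue (R.map TamC.toLocal)) ∧
      (∀ E ∈ R.map TamC.toLocal, ∀ v : IsDedekindDomain.HeightOneSpectrum (NumberField.RingOfIntegers ℚ),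
        Rat.HeightOneSpectrum.natGenerator v = E.p → tam (rank3Table[i]'hi).intModel v ∈ E.vals) ∧
      (∀ v : IsDedekindDomain.HeightOneSpectrum (NumberField.RingOfIntegers ℚ),
        Rat.HeightOneSpectrum.natGenerator v ∉ (R.map TamC.toLocal).map (·.p) →
          tam (rank3Table[i]'hi).intModel v = 1) := by
  simp only [rank3TamCerts, List.mem_append, or_assoc] at hm
  rcases hm with hm | hm | hm | hm | hm | hm | hm | hm | hm | hm | hm | hm | hm | hm | hm | hm |
    hm | hm | hm | hm | hm | hm | hm | hm | hm | hm | hm | hm | hm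
  · exact tamagawa_of_tamWalk rank3Table_tamWalk1 hm
  · exact tamagawa_of_tamWalk rank3Table_tamWalk2 hm
  · exact tamagawa_of_tamWalk rank3Table_tamWalk3 hm
  · exact tamagawa_of_tamWalk rank3Table_tamWalk4 hm
  · exact tamagawa_of_tamWalk rank3Table_tamWalk5 hm
  · exact tamagawa_of_tamWalk rank3Table_tamWalk6 hm
  · exact tamagawa_of_tamWalk rank3Table_tamWalk7 hm
  · exact tamagawa_of_tamWalk rank3Table_tamWalk8 hm
  · exact tamagawa_of_tamWalk rank3Table_tamWalk9 hm
  · exact tamagawa_of_tamWalk rank3Table_tamWalk10 hm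
  · exact tamagawa_of_tamWalk rank3Table_tamWalk11 hm
  · exact tamagawa_of_tamWalk rank3Table_tamWalk12 hm
  · exact tamagawa_of_tamWalk rank3Table_tamWalk13 hm
  · exact tamagawa_of_tamWalk rank3Table_tamWalk14 hm
  · exact tamagawa_of_tamWalk rank3Table_tamWalk15 hm
  · exact tamagawa_of_tamWalk rank3Table_tamWalk16 hm
  · exact tamagawa_of_tamWalk rank3Table_tamWalk17 hm
  · exact tamagawa_of_tamWalk rank3Table_tamWalk18 hm
  · exact tamagawa_of_tamWalk rank3Table_tamWalk19 hm
  · exact tamagawa_of_tamWalk rank3Table_tamWalk20 hm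
  · exact tamagawa_of_tamWalk rank3Table_tamWalk21 hm
  · exact tamagawa_of_tamWalk rank3Table_tamWalk22 hm
  · exact tamagawa_of_tamWalk rank3Table_tamWalk23 hm
  · exact tamagawa_of_tamWalk rank3Table_tamWalk24 hm
  · exact tamagawa_of_tamWalk rank3Table_tamWalk25 hm
  · exact tamagawa_of_tamWalk rank3Table_tamWalk26 hm
  · exact tamagawa_of_tamWalk rank3Table_tamWalk27 hm
  · exact tamagawa_of_tamWalk rank3Table_tamWalk28 hm
  · exact tamagawa_of_tamWalk rank3Table_tamWalk29 hm

/-- Index form: EVERY row of the census has a kernel-certified Tamagawa product set (a certified numeral on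
exact rows). [cite: SilvermanATAEC1994, IV.9.4] -/
theorem tamagawaProduct_certified (i : ℕ) (hi : i < rank3Table.length) :
    ∃ R : List TamC, (i, R) ∈ rank3TamCerts ∧
      (rank3Table[i]'hi).curve.tamagawaProduct ∈ TamLocal.rowVals (R.map TamC.toLocal) ∧
      (TamLocal.rowExact (R.map TamC.toLocal) = true →
        (rank3Table[i]'hi).curve.tamagawaProduct = TamLocal.rowValue (R.map TamC.toLocal)) := by
  obtain ⟨R, hm⟩ := exists_listed (i := i) (by rw [rank3Table_length] at hi; exact hi)
  obtain ⟨_, -, hmem, hex, -, -⟩ := tamagawa_census hm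
  exact ⟨R, hm, hmem, hex⟩

/-! ### Kernel-counted statistics -/

/-- `31050` local certificates (bad primes) in all. [cite: CremonaAlgorithms1997, Table 1] -/
theorem rank3TamCerts_count : (rank3TamCerts.map fun x => x.2.length).sum = 31050 := by
  decide +kernel

set_option maxHeartbeats 2000000 in
/-- By kind: 11410 split multiplicative, 2227 + 11564 non-split (exhaustion / Euler), 2166 Step-2, 3683 deep Tate
certificates. [cite: SilvermanATAEC1994, IV.9.4] -/
theorem rank3TamCerts_kinds :
    ((rank3TamCerts.flatMap (·.2)).map fun c => c.toLocal.kind).count 1 = 11410 ∧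
    ((rank3TamCerts.flatMap (·.2)).map fun c => c.toLocal.kind).count 2 = 2227 ∧
    ((rank3TamCerts.flatMap (·.2)).map fun c => c.toLocal.kind).count 3 = 11564 ∧
    ((rank3TamCerts.flatMap (·.2)).map fun c => c.toLocal.kind).count 4 = 2166 ∧
    ((rank3TamCerts.flatMap (·.2)).map fun c => c.toLocal.kind).count 5 = 3683 := by
  refine ⟨?_, ?_, ?_, ?_, ?_⟩ <;> decide +kernel

/-- `5442` rows are KERNEL-EXACT, `4045` KERNEL-BRACKETED. [cite: SilvermanATAEC1994, IV.9.4] -/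
theorem rank3TamCerts_exact_count :
    (rank3TamCerts.filter fun x => TamLocal.rowExact (x.2.map TamC.toLocal)).length = 5442 ∧
    (rank3TamCerts.filter fun x => !TamLocal.rowExact (x.2.map TamC.toLocal)).length = 4045 := by
  refine ⟨?_, ?_⟩ <;> decide +kernel

/-- Every certified set has at most `12` elements. [cite: SilvermanATAEC1994, IV.9.4] -/
theorem rank3TamCerts_rowVals_length_le :
    (rank3TamCerts.all fun x => decide ((TamLocal.rowVals (x.2.map TamC.toLocal)).length ≤ 12)) = true := by
  decide +kernel

/-- `∏_v c_v = 1` is kernel-certified (exact row with `rowValue = 1`) for exactly `458` rows; the largest certified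
exact product is `480`. [cite: CremonaAlgorithms1997, Table 1] -/
theorem rank3TamCerts_exact_one_count :
    (rank3TamCerts.filter fun x => TamLocal.rowExact (x.2.map TamC.toLocal) &&
      decide (TamLocal.rowValue (x.2.map TamC.toLocal) = 1)).length = 458 ∧
    (rank3TamCerts.all fun x => !TamLocal.rowExact (x.2.map TamC.toLocal) ||
      decide (TamLocal.rowValue (x.2.map TamC.toLocal) ≤ 480)) = true := by
  refine ⟨?_, ?_⟩ <;> decide +kernel

end Summit.BirchSwinnertonDyer.BirchSwinnertonDyer.Rank2Observatory.Tam
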